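import Literature.MathematicalPhysics.QuantumFieldTheory.Balaban1983to89.B15Prop1IntrinsicOfFun

/-!
# `Balaban1983to89.B15Prop1AnalyticExtNearRadius` — [Balaban1989LargeFieldI] = «[IV]», Prop. 1 p. 194 (the analytic-extension clause «with B′ ∈ 𝔤ᶜ and small,
# e.g., |B′| < ε»), (1.74) p. 192 («It is defined in each component of Z separately»); [Balaban1989LargeFieldII] = «[LF-II]», (1.2)–(1.6) p. 357, (1.12)–(1.13) p. 359
# («valid for 𝔤ᶜ-valued fields, hence the existence of the analytic extension follows immediately»), (1.15) p. 359:
# THE ANALYTIC-EXTENSION CLAUSE AT THE NEAR RADIUS — the clause's radius read off a holomorphic extension of the NEAR value instead of the total value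

Honest framing: statement-level skeleton of published theorems with citation tags; proofs where landed; nothing here is a claim about the Yang–Mills mass gap.  Cell `pub-ymgap`
(HUMAN RULINGS D-0062 ∕ D-0149), lane `pub-ymgap-dag-n12-c` g28 (R134 seat (a), N12 = [B15], s1; census axis U3-b of the lane memo `N12-UNIFORMITY-SPEC.md` §4 v3); count-neutral helper
of K1⁹ `stmt-QuantumFields-27364` (`--kind proof --supports`); N12 NOT discharged; one finite 𝕋⁴ programme at fixed ε; nothing continuum ∕ ℝ⁴ ∕ OS ∕ mass-gap ∕ Clay.  THEOREMS ONLY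
(0 `def`, 0 `instance`, 0 `sorry`).

WHY.  After the lane's U3 (β)(γ) editions (`B15Prop1GradientFromNearValue` v1.1 §4, `B15Prop1CoerciveEditionNearExt`, `B15Prop1WindowDirectPackageNearExt`; dag-n12-d's (T1)–(T5)) the
ONLY row of N12's displayed Proposition-1 product that still reads the TORUS is the radius of the analytic-extension clause,
`min(1∕2, R∕8, γ∕M⁵·(R∕2)²∕(48·(4𝓐∕R + 1)))` with `𝓐 = |Plaq(T_η)|·(1 + 8𝓐₀⁴)` the bound of the TOTAL joint extension (J1) (`B15Prop1IntrinsicAnalyticExt.anExt_of_jointHolomorphic`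
reads `𝓐` only through the Cauchy bound `4𝓐∕R` of the `B̃′`-gradient family).  Print's function (1.77) is the total action of `U_{k,Z}`; its NEAR part (the plaquettes meeting `Ω₁(Z)`,
[IV] (1.74) «defined in each component of Z separately», [LF-II] (1.15) `A = A(ζ₀) + A(1 − ζ₀)`) has its own joint holomorphic extension (J1ˢ) with the NEAR count
(`B15Prop1NearValueOfMinimiserFamily`), and the two functions differ, along every variation of the `Λ`-variables through a chart point, by a CONSTANT (the far action of the pinned
datum; `B15Prop1GradientFromNearValue.fun177std_dichotomy`'s mechanism) whenever (1.74) is solvable there.  THIS FILE turns that into the clause at the NEAR radius, generically: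

* §1 ★ `prop1Printed_lfVarOn_std_of_An` — `B15.Prop1Printed (lfVarOn ch I)` reads an instance's clause slot `An` only as its LAST, POSITIVE conjunct (`B15Prop1Carrier.prop1Printed_lfVarOn_iff`),
  so Proposition 1 at `InstOn.std … a₁ An₁` together with «`An₂ i ε V_k` for every `ε`-regular `V_k` below a threshold» gives Proposition 1 at `InstOn.std … a₁ An₂` — NO intermediate
  of the `_ofCoercive` chain needs a twin.
* §2 transfer along the variables: `isCriticalPt_iff_of_eventually_eq_add_const` (criticality through the chart is a first-derivative condition along one-bond variations, so it is
  shared by two functions differing by a constant along them), `anExt_of_anExt_of_isCriticalPt_imp` (the clause mentions `f` only through `IsCriticalPt`,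
  `B15Prop1AnalyticExtClause.anExt` :157), and the slice bookkeeping `sliceFn_eq_add_const_of_transfer` ∕ `rGrad_sliceFn_eq_of_transfer` ∕ `fderiv_rGrad_sliceFn_eq_of_transfer` ∕
  `eventually_eq_add_const_along_of_transfer` from ONE transfer letter «`f W = fh W + C` for every `W` equal to the datum off the `Λ`-bonds and bondwise `ρ`-close to it».
* §3 ★★★ `anExt_nearRadius_of_jointHolomorphic` — the clause `anExt S T f ext r ε V_k` at the radii of `anExt_of_jointHolomorphic` computed with `𝓑S = 4𝓐S∕R + 1`, `𝓐S` the bound of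
  the NEAR pair's extension: `anExt_of_jointHolomorphic` is run on `(fh, 𝒢S, 𝓐S)` — its `hpos`∕`hj` rows are `f`'s (the slice functions differ by a constant near `0`), its `hcrit` row is
  `IsCriticalPt fh ⇒ IsCriticalPt f ⇒ rGrad (sliceFn f) = 0` (the total extension's slice package + `f`'s `Λ`-gauge invariance, as in `B15Prop1IntrinsicOfFun`) `⇒ rGrad (sliceFn fh) = 0` —
  and the resulting clause for `fh` is transferred back to `f`.  No identity theorem in several complex variables is used.

HONEST SCOPE.  Generic (any `f`, `fh`, `ext`, datum); the transfer letter and both joint extensions are HYPOTHESES here (discharged on the (J0′) minimiser-family road in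
`B15Prop1CoerciveEditionNearRadius`); the near radius is region-size dependent (census grade (b)), NOT print's `(d, L, M)`-constant ([Balaban1985Variational] (190) ⇐ (189) decay, untouched);
nothing of Bałaban's asserted; count-neutral; N12 NOT discharged; K1⁹ NOT closed; R4 closes only the conditional finite-𝕋⁴ rung `BalabanLadder.UV` — no summit statement is proved here and
NOT the Yang–Mills mass gap (Clay); nothing continuum ∕ ℝ⁴ ∕ OS.
-/

noncomputable section

open Set Metric Filter
open scoped Topology InnerProductSpace

namespace Literature.MathematicalPhysics.QuantumFieldTheory.Balaban1983to89.B15Prop1AnalyticExtNearRadius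

open B15DeterminingSets GaugeField B16Sect1Backgrounds B15Prop1Carrier B8Eq17ClassAkV1
open B15Prop1SliceTaylorCalculus B15Prop1IntrinsicAnalyticExt B15Prop1ParametricZeroBranch
open B15Prop1CriticalViaSlice (isCriticalPt_iff_of_hasDerivAt)
open B15Prop1ChartRecentering (exists_hasFDerivAt_of_differentiableAt)
open B15Prop1AnalyticExtClause (cplxVec cplxSlice norm_cplxVec anExt anExt_antitone)
open B15Prop1ChartCalculusSU2 (E3)
open T4CubeChartGnomonic (SU2)
open B15Prop1ChartSU2 (su2Chart dist1_iexp_le)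
open B15Prop1SliceCoordinates (GaugeSlice ιA freeBonds mem_freeBonds ιA_apply_of_not_mem norm_ιA_apply_le)
open T4AxialGaugeFixing (TreeOrder)
open B15Sect1Instances

/-! ## §1  The upgrade lemma: Proposition 1's clause slot is its last, positive conjunct -/

section Upgrade

variable {P : Params} {G : Type} [GaugeGroup G] {𝔤 : Type*} [AddCommGroup 𝔤] [Module ℝ 𝔤]

/-- ★ **UPGRADING THE ANALYTIC-EXTENSION CLAUSE OF PROPOSITION 1 AT THE CARRIER OF RECORD.**  For a family of print's instances `InstOn.std (bg i) (M₁ i) (Z i) (Λ i) (k i) (M i) (a₁ i) (An i)`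
(any backgrounds, any chart), if Proposition 1 [IV] holds with the clause slots `An₁` and, for every instance, `An₂ i ε V_k` holds for every `ε`-regular datum `V_k` (`|∂V_k − 1| < ε` on
`(Z ∩ Λᶜ)^{(k)}`) below some threshold `e₁ > 0`, then Proposition 1 holds with the clause slots `An₂` (the threshold `e0` of p. 194 becomes `min e0 e₁`): the clause is the last, positive
conjunct of `B15.Prop1Printed (lfVarOn ch I)` (`prop1Printed_lfVarOn_iff`). [cite: Balaban1989LargeFieldI, Prop. 1 p.194 («for ε > 0 sufficiently small … has an analytic extension»)] -/
theorem prop1Printed_lfVarOn_std_of_An (ch : ExpChart G 𝔤) {ι : Type} {av : ι → ∀ j, Averaging P j G} (bg : ∀ i, DetBackground P G (av i)) (M₁ : ι → ℕ)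
    (Z Λ : ι → Set (Site P 0)) (k : ι → ℕ) (M a₁ : ι → ℝ) (An₁ An₂ : ∀ i, ℝ → GaugeField P (k i) G → Prop)
    (h : B15.Prop1Printed (lfVarOn ch fun i => InstOn.std (bg i) (M₁ i) (Z i) (Λ i) (k i) (M i) (a₁ i) (An₁ i)))
    (hAn : ∀ i, ∃ e₁ : ℝ, 0 < e₁ ∧ ∀ ε : ℝ, 0 < ε → ε ≤ e₁ → ∀ Vk : GaugeField P (k i) G,
      PlaqSmallOn (plaqsInside (pts (k i) (Z i ∩ (Λ i)ᶜ))) ε Vk → An₂ i ε Vk) :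
    B15.Prop1Printed (lfVarOn ch fun i => InstOn.std (bg i) (M₁ i) (Z i) (Λ i) (k i) (M i) (a₁ i) (An₂ i)) := by
  rw [prop1Printed_lfVarOn_iff] at h ⊢
  obtain ⟨B₅, hB₅, hall⟩ := h
  refine ⟨B₅, hB₅, fun i => ?_⟩
  obtain ⟨e0, he0, h0⟩ := hall i
  obtain ⟨e₁, he₁, h₁⟩ := hAn i
  refine ⟨min e0 e₁, lt_min he0 he₁, fun ε hε hεle Vk hV => ?_⟩
  obtain ⟨O, hO₁, hO₂, hO₃, hO₄, -⟩ := h0 ε hε (hεle.trans (min_le_left _ _)) Vk hV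
  exact ⟨O, hO₁, hO₂, hO₃, hO₄, h₁ ε hε (hεle.trans (min_le_right _ _)) Vk hV⟩

end Upgrade

/-! ## §2  Transfer along the `Λ`-variables: two functions differing by a constant there share critical points, slice gradients and the clause -/

section Transfer

variable {P : Params} {k : ℕ} [DecidableEq (PBond P k)]

omit [DecidableEq (PBond P k)] in
/-- **CRITICALITY THROUGH THE CHART IS SHARED BY TWO FUNCTIONS DIFFERING BY A CONSTANT ALONG THE VARIATIONS**: if for every direction `A` supported on `Λb` the functions `f`, `fh` differ by a
constant along `s ↦ exp(isA)·U` near `s = 0`, then `U` is critical for `f` iff for `fh` (`IsCriticalPt` = every such variation has derivative `0` at `s = 0`, `B15Prop1Carrier.IsCriticalPt`).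
[cite: Balaban1989LargeFieldII, (1.12) p.359; Balaban1989LargeFieldI, Prop. 1 p.194] -/
theorem isCriticalPt_iff_of_eventually_eq_add_const {Λb : Set (PBond P k)} {f fh : GaugeField P k SU2 → ℝ} {U : GaugeField P k SU2}
    (h : ∀ A : VecField P k E3, IsSupportedOn Λb A → ∃ C : ℝ,
      ∀ᶠ s in 𝓝 (0 : ℝ), f (expMul su2Chart (s • A) U) = fh (expMul su2Chart (s • A) U) + C) :
    IsCriticalPt su2Chart Λb f U ↔ IsCriticalPt su2Chart Λb fh U := by
  refine ⟨fun hc A hA => ?_, fun hc A hA => ?_⟩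
  · obtain ⟨C, hC⟩ := h A hA
    have h1 : HasDerivAt (fun s : ℝ => f (expMul su2Chart (s • A) U) - C) 0 0 := by
      simpa using (hc A hA).sub_const C
    exact h1.congr_of_eventuallyEq (hC.mono fun s hs => by simp only [hs, add_sub_cancel_right])
  · obtain ⟨C, hC⟩ := h A hA
    have h1 : HasDerivAt (fun s : ℝ => fh (expMul su2Chart (s • A) U) + C) 0 0 := by
      simpa using (hc A hA).add_const C
    exact h1.congr_of_eventuallyEq hC

/-- **THE CLAUSE MENTIONS `f` ONLY THROUGH ITS CRITICAL CONFIGURATIONS**: if at every chart point of the clause's range criticality for `f` implies criticality for `fh`, then the clause for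
`fh` gives the clause for `f` (same map `Φ`, same radii). [cite: Balaban1989LargeFieldI, Prop. 1 p.194 (the analytic-extension clause)] -/
theorem anExt_of_anExt_of_isCriticalPt_imp {S : Set (Site P k)} {T : Finset (PBond P k)} {f fh : GaugeField P k SU2 → ℝ}
    {ext : GaugeField P k SU2 → GaugeField P k SU2} {r ε : ℝ} {Vk : GaugeField P k SU2}
    (himp : ∀ p : VecField P k E3, ‖p‖ < ε → ∀ B : GaugeSlice S T E3, ‖B‖ ≤ r →
      IsCriticalPt su2Chart (bondsOf S) f (expMul su2Chart (ιA S T B) (ext (expMul su2Chart p Vk))) →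
        IsCriticalPt su2Chart (bondsOf S) fh (expMul su2Chart (ιA S T B) (ext (expMul su2Chart p Vk))))
    (h : anExt S T fh ext r ε Vk) : anExt S T f ext r ε Vk := by
  obtain ⟨Φ, hΦ, hreal⟩ := h
  exact ⟨Φ, hΦ, fun p hp B hB hc => hreal p hp B hB (himp p hp B hB hc)⟩

/-- A coordinate configuration `exp(i·ιA B)·W₀` agrees with `W₀` off the bonds meeting `S` (`ιA B` vanishes there) and is bondwise `‖B‖`-close to it (`dist1 (exp iX) ≤ ‖X‖`,
`‖ιA B (b)‖ ≤ ‖B‖`). [cite: Balaban1989LargeFieldII, p.359 («we can write V′ = exp iB′»); Balaban1989LargeFieldI, (1.77) p.194] -/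
theorem expMul_ιA_agrees_and_close {S : Set (Site P k)} {T : Finset (PBond P k)} (B : GaugeSlice S T E3) (W₀ : GaugeField P k SU2) :
    (∀ b, b ∉ bondsOf S → expMul su2Chart (ιA S T B) W₀ b = W₀ b) ∧
      ∀ b, dist1 (expMul su2Chart (ιA S T B) W₀ b * (W₀ b)⁻¹) ≤ ‖B‖ := by
  refine ⟨fun b hb => ?_, fun b => ?_⟩
  · have hfree : b ∉ freeBonds S T := fun h => hb (mem_freeBonds.1 h).1
    show su2Chart.iexp (ιA S T B b) * W₀ b = W₀ b
    rw [ιA_apply_of_not_mem B hfree, su2Chart.iexp_zero, one_mul]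
  · show dist1 (su2Chart.iexp (ιA S T B b) * W₀ b * (W₀ b)⁻¹) ≤ ‖B‖
    rw [mul_inv_cancel_right]
    exact (dist1_iexp_le _).trans (norm_ιA_apply_le B b)

/-- **THE SLICE FUNCTIONS OF TWO FUNCTIONS RELATED BY THE TRANSFER LETTER DIFFER BY ITS CONSTANT ON THE BALL `‖B‖ < ρ`.**  Transfer letter at the datum `W₀`: `f W = fh W + C` for every
`W` equal to `W₀` off the bonds meeting `S` and bondwise `ρ`-close to `W₀`. [cite: Balaban1989LargeFieldII, (1.15) p.359, p.359 (the function «expanded with respect to B′»)] -/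
theorem sliceFn_eq_add_const_of_transfer {S : Set (Site P k)} {T : Finset (PBond P k)} {f fh : GaugeField P k SU2 → ℝ} {W₀ : GaugeField P k SU2}
    {C ρ : ℝ} (htr : ∀ W : GaugeField P k SU2, (∀ b, b ∉ bondsOf S → W b = W₀ b) → (∀ b, dist1 (W b * (W₀ b)⁻¹) < ρ) → f W = fh W + C)
    {B : GaugeSlice S T E3} (hB : ‖B‖ < ρ) : sliceFn S T f W₀ B = sliceFn S T fh W₀ B + C := by
  rw [sliceFn_apply, sliceFn_apply]
  obtain ⟨hag, hcl⟩ := expMul_ιA_agrees_and_close B W₀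
  exact htr _ hag fun b => (hcl b).trans_lt hB

/-- **… HENCE ONE SLICE GRADIENT ON THAT BALL** (the gradients of two functions differing by a constant near a point agree there). [cite: Balaban1989LargeFieldII, (1.12) p.359] -/
theorem rGrad_sliceFn_eq_of_transfer {S : Set (Site P k)} {T : Finset (PBond P k)} {f fh : GaugeField P k SU2 → ℝ} {W₀ : GaugeField P k SU2}
    {C ρ : ℝ} (htr : ∀ W : GaugeField P k SU2, (∀ b, b ∉ bondsOf S → W b = W₀ b) → (∀ b, dist1 (W b * (W₀ b)⁻¹) < ρ) → f W = fh W + C)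
    {X : GaugeSlice S T E3} (hX : ‖X‖ < ρ) : rGrad S T (sliceFn S T fh W₀) X = rGrad S T (sliceFn S T f W₀) X := by
  have hev : (sliceFn S T fh W₀) =ᶠ[𝓝 X] fun B => sliceFn S T f W₀ B - C := by
    have hopen : IsOpen (ball (0 : GaugeSlice S T E3) ρ) := isOpen_ball
    filter_upwards [hopen.mem_nhds (mem_ball_zero_iff.2 hX)] with B hB
    rw [sliceFn_eq_add_const_of_transfer htr (mem_ball_zero_iff.1 hB), add_sub_cancel_right]
  rw [rGrad_def, rGrad_def]
  show rieszR S T (fderiv ℝ (sliceFn S T fh W₀) X) = rieszR S T (fderiv ℝ (sliceFn S T f W₀) X)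
  rw [hev.fderiv_eq, fderiv_sub_const]

/-- **… HENCE ONE SLICE HESSIAN AT `0`** (`ρ > 0`). [cite: Balaban1989LargeFieldII, (1.7)–(1.9) p.358, (1.12) p.359] -/
theorem fderiv_rGrad_sliceFn_eq_of_transfer {S : Set (Site P k)} {T : Finset (PBond P k)} {f fh : GaugeField P k SU2 → ℝ} {W₀ : GaugeField P k SU2}
    {C ρ : ℝ} (hρ : 0 < ρ) (htr : ∀ W : GaugeField P k SU2, (∀ b, b ∉ bondsOf S → W b = W₀ b) → (∀ b, dist1 (W b * (W₀ b)⁻¹) < ρ) → f W = fh W + C) :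
    fderiv ℝ (rGrad S T (sliceFn S T fh W₀)) 0 = fderiv ℝ (rGrad S T (sliceFn S T f W₀)) 0 := by
  have hev : rGrad S T (sliceFn S T fh W₀) =ᶠ[𝓝 0] rGrad S T (sliceFn S T f W₀) := by
    filter_upwards [isOpen_ball.mem_nhds (mem_ball_self hρ : (0 : GaugeSlice S T E3) ∈ ball 0 ρ)] with X hX
    exact rGrad_sliceFn_eq_of_transfer htr (mem_ball_zero_iff.1 hX)
  exact hev.fderiv_eq

/-- **ALONG EVERY ONE-BOND VARIATION OF THE `Λ`-VARIABLES THROUGH A COORDINATE CONFIGURATION `exp(i·ιA B)·W₀`, `‖B‖ < ρ`, THE TWO FUNCTIONS DIFFER BY THE CONSTANT NEAR `s = 0`**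
(the variation stays among the variables of (1.77) and stays bondwise `ρ`-close to `W₀` for small `s`: `dist1` is subadditive, `dist1 (exp iX) ≤ ‖X‖`).
[cite: Balaban1989LargeFieldI, (1.77) p.194; Balaban1989LargeFieldII, (1.12) p.359] -/
theorem eventually_eq_add_const_along_of_transfer {S : Set (Site P k)} {T : Finset (PBond P k)} {f fh : GaugeField P k SU2 → ℝ} {W₀ : GaugeField P k SU2}
    {C ρ : ℝ} (htr : ∀ W : GaugeField P k SU2, (∀ b, b ∉ bondsOf S → W b = W₀ b) → (∀ b, dist1 (W b * (W₀ b)⁻¹) < ρ) → f W = fh W + C)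
    {B : GaugeSlice S T E3} (hB : ‖B‖ < ρ) (A : VecField P k E3) (hA : IsSupportedOn (bondsOf S) A) :
    ∀ᶠ s in 𝓝 (0 : ℝ), f (expMul su2Chart (s • A) (expMul su2Chart (ιA S T B) W₀)) = fh (expMul su2Chart (s • A) (expMul su2Chart (ιA S T B) W₀)) + C := by
  have hδ : 0 < (ρ - ‖B‖) / (‖A‖ + 1) := div_pos (sub_pos.2 hB) (by positivity)
  filter_upwards [Metric.ball_mem_nhds (0 : ℝ) hδ] with s hs
  rw [Metric.mem_ball, dist_zero_right, Real.norm_eq_abs] at hs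
  refine htr _ (fun b hb => ?_) (fun b => ?_)
  · have hfree : b ∉ freeBonds S T := fun h => hb (mem_freeBonds.1 h).1
    show su2Chart.iexp ((s • A) b) * (su2Chart.iexp (ιA S T B b) * W₀ b) = W₀ b
    rw [Pi.smul_apply, hA b hb, smul_zero, ιA_apply_of_not_mem B hfree, su2Chart.iexp_zero, one_mul, one_mul]
  · show dist1 (su2Chart.iexp ((s • A) b) * (su2Chart.iexp (ιA S T B b) * W₀ b) * (W₀ b)⁻¹) < ρ
    rw [← mul_assoc, mul_inv_cancel_right]
    have hAb : ‖(s • A) b‖ ≤ |s| * ‖A‖ := by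
      rw [Pi.smul_apply, norm_smul, Real.norm_eq_abs]
      exact mul_le_mul_of_nonneg_left (norm_le_pi_norm A b) (abs_nonneg s)
    have hsA : |s| * ‖A‖ < ρ - ‖B‖ := by
      have h1 : |s| * ‖A‖ ≤ |s| * (‖A‖ + 1) := mul_le_mul_of_nonneg_left (by linarith) (abs_nonneg s)
      have h2 : |s| * (‖A‖ + 1) < (ρ - ‖B‖) / (‖A‖ + 1) * (‖A‖ + 1) := mul_lt_mul_of_pos_right hs (by positivity)
      rw [div_mul_cancel₀ _ (by positivity : (‖A‖ + 1) ≠ 0)] at h2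
      linarith
    calc dist1 (su2Chart.iexp ((s • A) b) * su2Chart.iexp (ιA S T B b))
        ≤ dist1 (su2Chart.iexp ((s • A) b)) + dist1 (su2Chart.iexp (ιA S T B b)) := GaugeGroup.dist1_mul_le _ _
      _ ≤ |s| * ‖A‖ + ‖B‖ := add_le_add ((dist1_iexp_le _).trans hAb) ((dist1_iexp_le _).trans (norm_ιA_apply_le B b))
      _ < ρ := by linarith

/-- **… SO A COORDINATE CONFIGURATION IS CRITICAL FOR `f` IFF FOR `fh`.** [cite: Balaban1989LargeFieldII, (1.12) p.359; Balaban1989LargeFieldI, Prop. 1 p.194] -/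
theorem isCriticalPt_iff_of_transfer {S : Set (Site P k)} {T : Finset (PBond P k)} {f fh : GaugeField P k SU2 → ℝ} {W₀ : GaugeField P k SU2}
    {C ρ : ℝ} (htr : ∀ W : GaugeField P k SU2, (∀ b, b ∉ bondsOf S → W b = W₀ b) → (∀ b, dist1 (W b * (W₀ b)⁻¹) < ρ) → f W = fh W + C)
    {B : GaugeSlice S T E3} (hB : ‖B‖ < ρ) :
    IsCriticalPt su2Chart (bondsOf S) f (expMul su2Chart (ιA S T B) W₀) ↔ IsCriticalPt su2Chart (bondsOf S) fh (expMul su2Chart (ιA S T B) W₀) :=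
  isCriticalPt_iff_of_eventually_eq_add_const fun A hA => ⟨C, eventually_eq_add_const_along_of_transfer htr hB A hA⟩

end Transfer


/-! ## §3  The analytic-extension clause at the NEAR radius -/

section NearRadius

variable {P : Params} {k : ℕ} [DecidableEq (PBond P k)]

/-- **THE RADII OF THE CLAUSE** (the bookkeeping of `B15Prop1IntrinsicOfFun`, where it is private, made available to the record editions): with `c = γ∕M⁵`, `𝓑 = 4𝓐∕R + 1`,
`rA = min(1∕2, R∕8, c(R∕2)²∕(48𝓑))`, `εA = min(2rA, c·(2rA)·(R∕2)∕(12𝓑))`, `eJ = c·(2rA)∕(6(cJ+1))`, all the smallness conditions of `anExt_of_jointHolomorphic` hold (with `r = rA`, `r′ = 2rA`).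
[cite: Balaban1989LargeFieldII, (1.13) p.359] -/
theorem near_radii_bookkeeping {R 𝓐 γ M cJ : ℝ} (hR : 0 < R) (h𝓐 : 0 ≤ 𝓐) (hγ : 0 < γ) (hM : 1 ≤ M) (hcJ : 0 ≤ cJ) :
    let c := γ / M ^ 5
    let 𝓑 := 4 * 𝓐 / R + 1
    let rA := min (1 / 2) (min (R / 8) (c * (R / 2) ^ 2 / (48 * 𝓑)))
    let εA := min (2 * rA) (c * (2 * rA) * (R / 2) / (12 * 𝓑))
    let eJ := c * (2 * rA) / (6 * (cJ + 1))
    0 < c ∧ 0 < rA ∧ rA ≤ 1 / 2 ∧ rA < 2 * rA ∧ 2 * rA ≤ R / 4 ∧ 2 * rA ≤ c * (R / 2) ^ 2 / (24 * 𝓑) ∧ 0 < εA ∧ εA ≤ 2 * rA ∧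
      εA ≤ c * (2 * rA) * (R / 2) / (12 * 𝓑) ∧ 0 < eJ ∧ cJ * eJ ≤ c * (2 * rA) / 6 ∧ rA ≤ R / 8 := by
  intro c 𝓑 rA εA eJ
  have hM0 : 0 < M := by linarith
  have hc : 0 < c := by positivity
  have h𝓑 : 0 < 𝓑 := by positivity
  have hrA : 0 < rA := lt_min (by norm_num) (lt_min (by linarith) (by positivity))
  have hrA2 : rA ≤ 1 / 2 := min_le_left _ _
  have hrAR : rA ≤ R / 8 := (min_le_right _ _).trans (min_le_left _ _)
  have hrAc : rA ≤ c * (R / 2) ^ 2 / (48 * 𝓑) := (min_le_right _ _).trans (min_le_right _ _)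
  have hεA : 0 < εA := lt_min (by linarith) (by positivity)
  have heJ : 0 < eJ := by positivity
  refine ⟨hc, hrA, hrA2, by linarith, by linarith, ?_, hεA, min_le_left _ _, min_le_right _ _, heJ, ?_, hrAR⟩
  · have e : c * (R / 2) ^ 2 / (24 * 𝓑) = 2 * (c * (R / 2) ^ 2 / (48 * 𝓑)) := by field_simp; ring
    rw [e]; linarith
  · have e : cJ * eJ = (cJ / (cJ + 1)) * (c * (2 * rA) / 6) := by
      show cJ * (c * (2 * rA) / (6 * (cJ + 1))) = cJ / (cJ + 1) * (c * (2 * rA) / 6)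
      field_simp
    rw [e]
    have h1 : cJ / (cJ + 1) ≤ 1 := by rw [div_le_one (by linarith)]; linarith
    have h2 : 0 ≤ c * (2 * rA) / 6 := by positivity
    calc cJ / (cJ + 1) * (c * (2 * rA) / 6) ≤ 1 * (c * (2 * rA) / 6) := mul_le_mul_of_nonneg_right h1 h2
      _ = c * (2 * rA) / 6 := one_mul _

/-- ★★★ **THE ANALYTIC-EXTENSION CLAUSE OF PROPOSITION 1 AT THE NEAR RADIUS.**  Data: the function `f` (print's (1.77)) and a companion `fh` (its near part), the extension `ext`, the datum
`V_k`; a slice tree `T` gauge-fixing `S = Λ^{(k)}` (`hT`, `hv`) and `f`'s invariance under the gauge transformations on `S` (`hf`, [IV] p. 194 «invariant with respect to the group of all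
gauge transformations defined on Λ»); (J1) a joint extension `𝒢` of `(p, B′) ↦ f(exp(iB′)·ext(exp(ip)V_k))`, complex-differentiable on the sup-ball of radius `R`, bounded by `𝓐` (this bound
does NOT enter the radii), real values `f`; (J1ˢ) a joint extension `𝒢S` of the same for `fh`, bounded by `𝓐S`; the TRANSFER LETTER `htr`: for every real `‖p‖ < R` a constant `C(p)` with
`f W = fh W + C(p)` for every `W` equal to `ext(exp(ip)V_k)` off the bonds meeting `S` and bondwise `ρ`-close to it; `f`'s slice Hessian coercivity `hpos` (constant `c`) and gradient bound
`hj` at the datum; radii `0 < r < r′ ≤ R∕4`, `r′ ≤ c(R∕2)²∕(24𝓑S)`, `ε ≤ r′`, `ε ≤ c·r′·(R∕2)∕(12𝓑S)`, `j ≤ c·r′∕6` with `𝓑S = 4𝓐S∕R + 1` — THE NEAR BOUND — and `r ≤ 1∕2`, `r < ρ`.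
Conclusion: `anExt S T f ext r ε V_k`.  Proof: `anExt_of_jointHolomorphic` for `(fh, 𝒢S, 𝓐S)` — its Hessian ∕ gradient rows are `f`'s (`fderiv_rGrad_sliceFn_eq_of_transfer`,
`rGrad_sliceFn_eq_of_transfer` at `p = 0`), its criticality row is `IsCriticalPt fh ⇒ IsCriticalPt f` (`isCriticalPt_iff_of_transfer`) `⇒ rGrad (sliceFn f) = 0` (the section of `𝒢` at
`p`: `slice_package_of_holomorphic`, `exists_hasFDerivAt_of_differentiableAt`, `isCriticalPt_iff_of_hasDerivAt` with `hf`) `⇒ rGrad (sliceFn fh) = 0` — then `anExt fh ⇒ anExt f`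
(`anExt_of_anExt_of_isCriticalPt_imp` with `IsCriticalPt f ⇒ IsCriticalPt fh`).
[cite: Balaban1989LargeFieldI, (1.74) p.192, Prop. 1 p.194 (incl. the last clause); Balaban1989LargeFieldII, (1.2)–(1.6) p.357, (1.7)–(1.9) p.358, (1.12)–(1.13) p.359, (1.15) p.359; Balaban1985Variational, Prop. 9 p.309] -/
theorem anExt_nearRadius_of_jointHolomorphic {S : Set (Site P k)} {T : Finset (PBond P k)} {v : PBond P k → Site P k} {rk : Site P k → ℕ}
    (hT : TreeOrder T v rk) (hv : ∀ b ∈ T, v b ∈ S)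
    (f fh : GaugeField P k SU2 → ℝ) (hf : ∀ u : GaugeTransf P k SU2, IsGaugeOn S u → ∀ V, f (gaugeAct u V) = f V)
    (ext : GaugeField P k SU2 → GaugeField P k SU2) (Vk : GaugeField P k SU2)
    {R 𝓐 𝓐S c j r r' ε ρ : ℝ} (hR : 0 < R) (h𝓐S : 0 ≤ 𝓐S)
    (𝒢 : VecField P k (EuclideanSpace ℂ (Fin 3)) × VecField P k (EuclideanSpace ℂ (Fin 3)) → ℂ)
    (h𝒢d : DifferentiableOn ℂ 𝒢 (ball 0 R))
    (h𝒢b : ∀ z ∈ ball (0 : VecField P k (EuclideanSpace ℂ (Fin 3)) × VecField P k (EuclideanSpace ℂ (Fin 3))) R, ‖𝒢 z‖ ≤ 𝓐)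
    (h𝒢r : ∀ (p B' : VecField P k E3), ‖p‖ < R → ‖B'‖ < R →
      𝒢 (cplxVec p, cplxVec B') = ((f (expMul su2Chart B' (ext (expMul su2Chart p Vk))) : ℝ) : ℂ))
    (𝒢S : VecField P k (EuclideanSpace ℂ (Fin 3)) × VecField P k (EuclideanSpace ℂ (Fin 3)) → ℂ)
    (h𝒢Sd : DifferentiableOn ℂ 𝒢S (ball 0 R))
    (h𝒢Sb : ∀ z ∈ ball (0 : VecField P k (EuclideanSpace ℂ (Fin 3)) × VecField P k (EuclideanSpace ℂ (Fin 3))) R, ‖𝒢S z‖ ≤ 𝓐S)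
    (h𝒢Sr : ∀ (p B' : VecField P k E3), ‖p‖ < R → ‖B'‖ < R →
      𝒢S (cplxVec p, cplxVec B') = ((fh (expMul su2Chart B' (ext (expMul su2Chart p Vk))) : ℝ) : ℂ))
    -- THE TRANSFER LETTER: along the `Λ`-variables near each perturbed datum, `f − fh` is a constant
    (htr : ∀ p : VecField P k E3, ‖p‖ < R → ∃ C : ℝ, ∀ W : GaugeField P k SU2,
      (∀ b, b ∉ bondsOf S → W b = ext (expMul su2Chart p Vk) b) → (∀ b, dist1 (W b * (ext (expMul su2Chart p Vk) b)⁻¹) < ρ) → f W = fh W + C)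
    (hc : 0 < c)
    (hpos : ∀ u : GaugeSlice S T E3, c * ‖u‖ ^ 2 ≤ ⟪u, fderiv ℝ (rGrad S T (sliceFn S T f (ext Vk))) 0 u⟫_ℝ)
    (hj : ‖rGrad S T (sliceFn S T f (ext Vk)) 0‖ ≤ j)
    (hr : 0 < r) (hrr' : r < r') (hr'R : r' ≤ R / 4) (hr'c : r' ≤ c * (R / 2) ^ 2 / (24 * (4 * 𝓐S / R + 1)))
    (hεr : ε ≤ r') (hεc : ε ≤ c * r' * (R / 2) / (12 * (4 * 𝓐S / R + 1))) (hjc : j ≤ c * r' / 6)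
    (hr2 : r ≤ 1 / 2) (hrρ : r < ρ) :
    anExt S T f ext r ε Vk := by
  -- the transfer letter at the base datum (`p = 0`)
  obtain ⟨C₀, hC₀⟩ := htr 0 (by rw [norm_zero]; exact hR)
  rw [expMul_zero] at hC₀
  have hρ0 : 0 < ρ := hr.trans hrρ
  -- `fh`'s Hessian and gradient rows are `f`'s
  have hposh : ∀ u : GaugeSlice S T E3, c * ‖u‖ ^ 2 ≤ ⟪u, fderiv ℝ (rGrad S T (sliceFn S T fh (ext Vk))) 0 u⟫_ℝ := fun u => by
    rw [fderiv_rGrad_sliceFn_eq_of_transfer hρ0 hC₀]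
    exact hpos u
  have hjh : ‖rGrad S T (sliceFn S T fh (ext Vk)) 0‖ ≤ j := by
    rw [rGrad_sliceFn_eq_of_transfer hC₀ (show ‖(0 : GaugeSlice S T E3)‖ < ρ by rw [norm_zero]; exact hρ0)]
    exact hj
  -- `fh`'s criticality row, through `f`'s
  have hcrith : ∀ p : VecField P k E3, ‖p‖ < R / 2 → ∀ B : GaugeSlice S T E3, ‖B‖ ≤ r →
      IsCriticalPt su2Chart (bondsOf S) fh (expMul su2Chart (ιA S T B) (ext (expMul su2Chart p Vk))) →
        rGrad S T (sliceFn S T fh (ext (expMul su2Chart p Vk))) B = 0 := by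
    intro p hp B hB hcr
    have hpR : ‖p‖ < R := by linarith
    obtain ⟨C, hC⟩ := htr p hpR
    have hBρ : ‖B‖ < ρ := hB.trans_lt hrρ
    -- criticality transfers to `f`
    have hcrf : IsCriticalPt su2Chart (bondsOf S) f (expMul su2Chart (ιA S T B) (ext (expMul su2Chart p Vk))) :=
      (isCriticalPt_iff_of_transfer hC hBρ).2 hcr
    -- `f`'s slice gradient vanishes there: the section of `𝒢` at `p` extends `f` at the perturbed datum (as in `B15Prop1IntrinsicOfFun`)
    have hpC : ‖cplxVec p‖ < R := by rw [norm_cplxVec]; exact hpR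
    obtain ⟨hdiff, hderiv, -, -⟩ := slice_package_of_holomorphic S T f (ext (expMul su2Chart p Vk)) hR (fun Bc => 𝒢 (cplxVec p, Bc))
      (differentiableOn_section 𝒢 h𝒢d hpC)
      (fun Y hY => h𝒢b _ (by rw [mem_ball_zero_iff] at hY ⊢; exact norm_prodMk_lt hpC hY))
      (fun B' hB' => h𝒢r p B' hpR hB')
    have hBR : ‖B‖ < R := by linarith
    have hB2 : ‖B‖ ≤ 1 / 2 := hB.trans hr2
    have hX : ∀ b, ‖ιA S T B b‖ < Real.pi := fun b =>
      (norm_ιA_apply_le B b).trans_lt (hB2.trans_lt (by linarith [Real.pi_gt_three]))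
    obtain ⟨D, hD⟩ := exists_hasFDerivAt_of_differentiableAt _ (ext (expMul su2Chart p Vk)) hX (hdiff B hBR)
    set g := sliceFn S T f (ext (expMul su2Chart p Vk)) with hg
    have hiff := isCriticalPt_iff_of_hasDerivAt hT hv hf (ext (expMul su2Chart p Vk)) hB2 hD
      (L := fun δ => ⟪δ, rGrad S T g B⟫_ℝ) (fun δ => by
        have h := hderiv B δ hBR
        rw [← inner_rGrad_eq_taylor] at h
        simpa only [hg, sliceFn_apply] using h)
    have hgf : rGrad S T g B = 0 := inner_self_eq_zero.1 (hiff.1 hcrf _)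
    rw [rGrad_sliceFn_eq_of_transfer hC hBρ]
    exact hgf
  -- the clause for `fh` at the near radius
  have hAh : anExt S T fh ext r ε Vk :=
    anExt_of_jointHolomorphic S T fh ext Vk hR h𝓐S 𝒢S h𝒢Sd h𝒢Sb h𝒢Sr hcrith hc hposh hjh hr hrr' hr'R hr'c hεr hεc hjc
  -- … transferred to `f`
  refine anExt_of_anExt_of_isCriticalPt_imp (fun p hp B hB hcr => ?_) hAh
  have hpR : ‖p‖ < R := by linarith [hεr.trans hr'R]
  obtain ⟨C, hC⟩ := htr p hpR
  exact (isCriticalPt_iff_of_transfer hC (hB.trans_lt hrρ)).1 hcr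

end NearRadius

end Literature.MathematicalPhysics.QuantumFieldTheory.Balaban1983to89.B15Prop1AnalyticExtNearRadius

end
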